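import Mathlib
import HarnessLib
import Literature.MathematicalPhysics.QuantumLattice.GaugeGroups
import Literature.MathematicalPhysics.QuantumFieldTheory.ConstructiveQFTWave0
import Literature.MathematicalPhysics.QuantumFieldTheory.U1GinibreComparison
import Summits.Ventures.LatticeQCDFlow.Exactness.CompactHaar
import Summits.Ventures.LatticeQCDFlow.Scaling.HaarConvolutionRatio
import Summits.Ventures.LatticeQCDFlow.Scaling.PlaquetteMarginals2D
import Summits.Ventures.LatticeQCDFlow.Scaling.LatticePeeling
import Summits.Ventures.LatticeQCDFlow.Scaling.FluxTunnellingU1Explicit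

/-!
# Haar-convolution powers on a commutative compact group as product integrals; the pairing inequality

HONEST FRAMING: exact (Metropolis-corrected) sampling algorithms for lattice gauge theory;
figures of merit are autocorrelation/cost numbers at stated couplings and volumes; no
continuum-physics claim.

Venture `LatticeQCDFlow` (cell pub-lqcd), topic `Scaling`, FANOUT row 29 (theory2, gen-20), item 101a
(first half of the compensation input of the sharp tunnelling floor, items 101–104).  NEW WORK over
Mathlib and lean-1's `Scaling/HaarConvolutionRatio` (row 30); nothing here is cited as a fact.

* §1 `iterate_eq_lintegral_pi` — for a commutative compact group `G` with its Haar probability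
  measure, the `m`-th Haar-convolution power of a weight applied to a function is an honest product
  integral, `(K_wᵐ φ)(u) = ∫ φ(u·∏ᵢ hᵢ)·∏ᵢ w(hᵢ) dHaar^{⊗m}(h)` (lean-1's `lmarginal` induction run
  over a general finite index type, `lmarginal_weight_prod_eq_iterate_index`);
* §2 `two_mul_exp_le_pair` — the elementary pairing inequality behind the compensation bound of
  `Scaling/ConvolutionPowerCompensation.lean`:
  `2·e^{−βM(1−a)}·∏ⱼ e^{−β(1−xⱼ)} ≤ ∏ⱼ e^{−β(1−(a xⱼ + b yⱼ))} + ∏ⱼ e^{−β(1−(a xⱼ − b yⱼ))}`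
  for `β ≥ 0`, `a ≤ 1`, `xⱼ ≤ 1` (from `eᴬ⁻ᴮ + eᴬ⁺ᴮ ≥ 2eᴬ`, `two_mul_exp_le_exp_add_exp`).
Elementary; no `def`.
-/

noncomputable section

namespace Summit.Ventures.LatticeQCDFlow.Theory2.HaarConv

open MeasureTheory Real
open Literature.MathematicalPhysics.QuantumFieldTheory Literature.MathematicalPhysics.QuantumLattice
open scoped ENNReal

/-! ## §1 The convolution power as a product integral (commutative compact `G`) -/

section Unfold

variable {G : Type*} [CommGroup G] [TopologicalSpace G] [IsTopologicalGroup G] [CompactSpace G]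
  [SecondCountableTopology G] [MeasurableSpace G] [BorelSpace G]

/-- lean-1's `lmarginal_weight_prod_eq_iterate` over an arbitrary index type:
`∫⋯∫_R φ(a·∏_{r∈R} g_r)·∏_{r∈R} w(g_r) dHaar^R = (K_w^{#R} φ)(a)` for `a` independent of the
`R`-coordinates. [folklore] -/
theorem lmarginal_weight_prod_eq_iterate_index {ι : Type*} [DecidableEq ι] {w φ : G → ℝ≥0∞}
    (hw : Measurable w) (hφ : Measurable φ) (R : Finset ι) {a : (ι → G) → G} (ham : Measurable a)
    (ha : ∀ g, ∀ r ∈ R, ∀ v, a (Function.update g r v) = a g) :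
    (∫⋯∫⁻_R, (fun g => φ (a g * ∏ r ∈ R, g r) * ∏ r ∈ R, w (g r))
        ∂fun _ : ι => haarProbability G) =
      fun g => (haarConv w)^[R.card] φ (a g) := by
  classical
  induction R using Finset.induction_on generalizing a with
  | empty => funext g; simp
  | @insert r R hr ih =>
    funext g
    have hmeas : Measurable fun g : ι → G =>
        φ (a g * ∏ r ∈ insert r R, g r) * ∏ r ∈ insert r R, w (g r) :=
      (hφ.comp (ham.mul (Finset.measurable_prod _ fun i _ => measurable_pi_apply i))).mul
        (Finset.measurable_prod _ fun i _ => hw.comp (measurable_pi_apply i))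
    rw [lmarginal_insert _ hmeas hr, Finset.card_insert_of_notMem hr, Function.iterate_succ_apply',
      haarConv]
    have hsplit : (fun g : ι → G => φ (a g * ∏ r ∈ insert r R, g r) * ∏ r ∈ insert r R, w (g r)) =
        fun g => (φ ((a g * g r) * ∏ r ∈ R, g r) * ∏ r ∈ R, w (g r)) * w (g r) := by
      funext g; rw [Finset.prod_insert hr, Finset.prod_insert hr]; simp only [mul_comm, mul_left_comm]
    have ha' : ∀ g, ∀ r' ∈ R, ∀ v, (fun g : ι → G => a g * g r) (Function.update g r' v) =
        (fun g : ι → G => a g * g r) g := by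
      intro g r' hr' v
      have hne : r ≠ r' := fun h => hr (h ▸ hr')
      simp only [ha g r' (Finset.mem_insert_of_mem hr') v, Function.update_of_ne hne]
    have hF : Measurable fun g : ι → G => φ ((a g * g r) * ∏ r ∈ R, g r) * ∏ r ∈ R, w (g r) :=
      (hφ.comp ((ham.mul (measurable_pi_apply r)).mul
        (Finset.measurable_prod _ fun i _ => measurable_pi_apply i))).mul
        (Finset.measurable_prod _ fun i _ => hw.comp (measurable_pi_apply i))
    have hc : ∀ x (y : (i : ↥R) → G), (fun g : ι → G => w (g r)) (Function.updateFinset x R y) =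
        (fun g : ι → G => w (g r)) x := by
      intro x y; simp [Function.updateFinset, hr]
    have hm' : Measurable fun g : ι → G => a g * g r := ham.mul (measurable_pi_apply r)
    have hih := ih (a := fun g => a g * g r) hm' ha'
    rw [hsplit, Lattice.TwoDim.lmarginal_mul_indep (haarProbability G) R hF hc]
    refine lintegral_congr fun v => ?_
    show (∫⋯∫⁻_R, (fun g => φ ((a g * g r) * ∏ r ∈ R, g r) * ∏ r ∈ R, w (g r))
        ∂fun _ : ι => haarProbability G) (Function.update g r v) * w (Function.update g r v r) = _
    rw [congrFun hih (Function.update g r v)]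
    simp only [Function.update_self, ha g r (Finset.mem_insert_self r R) v]

/-- **THE CONVOLUTION POWER AS A PRODUCT INTEGRAL**:
`(K_wᵐ φ)(u) = ∫ φ(u·∏ᵢ hᵢ)·∏ᵢ w(hᵢ) dHaar^{⊗m}(h)` over `U(1)^m = (Fin m → G)`. [folklore] -/
theorem iterate_eq_lintegral_pi {w φ : G → ℝ≥0∞} (hw : Measurable w) (hφ : Measurable φ) (m : ℕ)
    (u : G) :
    (haarConv w)^[m] φ u =
      ∫⁻ h, φ (u * ∏ i, h i) * ∏ i, w (h i) ∂(Measure.pi fun _ : Fin m => haarProbability G) := by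
  classical
  have h := congrFun (lmarginal_weight_prod_eq_iterate_index (ι := Fin m) hw hφ Finset.univ
    (a := fun _ => u) measurable_const (fun _ _ _ _ => rfl)) (fun _ => 1)
  rw [Finset.card_univ, Fintype.card_fin] at h
  rw [← h, lintegral_eq_lmarginal_univ (fun _ : Fin m => (1 : G))]

end Unfold

/-! ## §2 The pairing inequality -/

/-- `2·eᴸ ≤ eᴬ⁻ᴮ + eᴬ⁺ᴮ` whenever `L ≤ A` (`cosh B ≥ 1`). [folklore] -/
theorem two_mul_exp_le_exp_add_exp {L A B : ℝ} (h : L ≤ A) :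
    2 * Real.exp L ≤ Real.exp (A - B) + Real.exp (A + B) := by
  have h1 : Real.exp (A - B) + Real.exp (A + B) = Real.exp A * (Real.exp B + Real.exp (-B)) := by
    rw [sub_eq_add_neg, Real.exp_add, Real.exp_add]; ring
  have h2 : 2 ≤ Real.exp B + Real.exp (-B) := by
    have h3 := Real.one_le_cosh B
    rw [Real.cosh_eq] at h3
    linarith
  have h4 : Real.exp L ≤ Real.exp A := Real.exp_le_exp.mpr h
  rw [h1]
  nlinarith [Real.exp_pos A, Real.exp_pos L]

/-- **THE PAIRING INEQUALITY**: for `β ≥ 0`, `a ≤ 1`, `xⱼ ≤ 1`,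
`2·e^{−βM(1−a)}·∏ⱼ e^{−β(1−xⱼ)} ≤ ∏ⱼ e^{−β(1−(a xⱼ + b yⱼ))} + ∏ⱼ e^{−β(1−(a xⱼ − b yⱼ))}`
(`M = #ι`). [folklore] -/
theorem two_mul_exp_le_pair {ι : Type*} [Fintype ι] {β a b : ℝ} (x y : ι → ℝ) (hβ : 0 ≤ β)
    (ha : a ≤ 1) (hx : ∀ j, x j ≤ 1) :
    2 * (Real.exp (-(β * ((Fintype.card ι : ℝ) * (1 - a)))) * ∏ j, Real.exp (-(β * (1 - x j)))) ≤
      ∏ j, Real.exp (-(β * (1 - (a * x j + b * y j)))) +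
        ∏ j, Real.exp (-(β * (1 - (a * x j - b * y j)))) := by
  rw [← Real.exp_sum, ← Real.exp_sum, ← Real.exp_sum, ← Real.exp_add]
  set A : ℝ := ∑ j, -(β * (1 - a * x j)) with hA
  set B : ℝ := ∑ j, β * b * y j with hB
  have h1 : ∑ j, -(β * (1 - (a * x j + b * y j))) = A + B := by
    rw [hA, hB, ← Finset.sum_add_distrib]
    exact Finset.sum_congr rfl fun j _ => by ring
  have h2 : ∑ j, -(β * (1 - (a * x j - b * y j))) = A - B := by
    rw [hA, hB, ← Finset.sum_sub_distrib]
    exact Finset.sum_congr rfl fun j _ => by ring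
  have hL : -(β * ((Fintype.card ι : ℝ) * (1 - a))) + ∑ j, -(β * (1 - x j)) ≤ A := by
    have hcard : -(β * ((Fintype.card ι : ℝ) * (1 - a))) = ∑ _j : ι, -(β * (1 - a)) := by
      rw [Finset.sum_const, Finset.card_univ, nsmul_eq_mul]; ring
    rw [hcard, ← Finset.sum_add_distrib, hA]
    refine Finset.sum_le_sum fun j _ => ?_
    have : 0 ≤ β * ((1 - a) * (1 - x j)) := mul_nonneg hβ (mul_nonneg (by linarith) (by linarith [hx j]))
    nlinarith
  rw [h1, h2, add_comm (Real.exp (A + B))]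
  exact two_mul_exp_le_exp_add_exp hL

end Summit.Ventures.LatticeQCDFlow.Theory2.HaarConv

end
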